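import Summits.BirchSwinnertonDyer.BirchSwinnertonDyer.Theorems.KolyvaginRankRigidityAtTwoKolyvaginSwapDefs
import Summits.BirchSwinnertonDyer.BirchSwinnertonDyer.Theorems.KolyvaginRankRigidityAtTwoRegularValueEngineTwoLevel
import Summits.BirchSwinnertonDyer.BirchSwinnertonDyer.Theorems.KolyvaginRankRigidityAtTwoSwapFromPiecesPrelims
import Summits.BirchSwinnertonDyer.BirchSwinnertonDyer.Theorems.KolyvaginRankRigidityAtTwoWalkFrameAlgebra
import Summits.BirchSwinnertonDyer.BirchSwinnertonDyer.Theorems.KolyvaginRankRigidityAtTwoWalkBridge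
import Literature.NumberTheory.EllipticCurves.HeegnerPointsOfConductor
import Literature.NumberTheory.EllipticCurves.HeegnerPointsKolyvaginEulerSystem
import HarnessLib

/-!
# Crux U1 `KolyvaginBoundedDefectAtTwo` (stmt-BirchSwinnertonDyer-28083), LINE 17 `kolyvagin_swap` — SHAPE / CONDUCTOR BOOKKEEPING LEMMAS
# (pen bsd-idea-1 v8.1 kernel, HOME `line17/SWalphaSplit.lean` sha16 7a3a1bbc3f455963, verbatim against `…KolyvaginSwapDefs.OppShape`)

Width seat `bsd-line-krr2-p2` g19 (ONE READER on LINE 17); `--supports stmt-BirchSwinnertonDyer-28083` (helper).  Small kernel lemmas used by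
the SWα⁗ landing (`…ShedSeedPrimeShapedAtTwo`) and the composition (`…KolyvaginSwapAssembly`): (visibility monotone in the exponent is the tree's
`KolyvaginLowerBoundAtTwo.two_pow_zsmul_ne_zero_of_le_swap`), the shape `Sh(t, a)` is monotone in the error (`free_mono`, `span_mono`, `oppShape_mono`), `KolSupp` / the margin
`M ≤ M(n)` are hereditary and extend by a fresh Kolyvagin prime, `E[n]` is killed by `n`, a class visible beyond `2^{x+1}` is not killed
by `2`, and the level exceeds any visible exponent.  Pure bookkeeping; nothing here proves SWα⁗, U1, a rung or BSD.  **BSD is NOT proved.**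
References (locators only): [cite: GrossLMS1991, §3 (3.3), §9] [cite: MazurRubin2004, §4.1].
Design: no definitions; `K : Type`; axioms `propext`, `Classical.choice`, `Quot.sound`.
-/

set_option autoImplicit false
-- the Theorems namespace of this sub repeats the summit name by design (D-0017 nested layout)
set_option linter.dupNamespace false

noncomputable section

open scoped Classical
open WeierstrassCurve NumberField IsDedekindDomain Field
open Literature.NumberTheory.GaloisRepresentations Literature.NumberTheory.EllipticCurves
open Literature.NumberTheory
open Summit.BirchSwinnertonDyer.BirchSwinnertonDyer.Theorems

namespace Summit.BirchSwinnertonDyer.BirchSwinnertonDyer.Theorems.KolyvaginAtTwo.KolyvaginSwap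

/-- Near-freeness is monotone in the error. -/
theorem free_mono {W : WeierstrassCurve ℚ} {K : Type} [Field K] [NumberField K] {M a d t : ℕ}
    {g : Fin t → galH1Torsion (W.baseChange K) ((2 ^ M : ℕ) : ℤ)} (had : a ≤ d)
    (hfree : ∀ b : Fin t → ℤ, (∀ σ ∈ torsionFixing (W.baseChange K) ((2 ^ (M + 1) : ℕ) : ℤ),
        h1Eval (W.baseChange K) ((2 ^ M : ℕ) : ℤ) (∑ i, b i • g i) σ = 0) → ∀ i, (2 : ℤ) ^ (M - a) ∣ b i) :
    ∀ b : Fin t → ℤ, (∀ σ ∈ torsionFixing (W.baseChange K) ((2 ^ (M + 1) : ℕ) : ℤ),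
        h1Eval (W.baseChange K) ((2 ^ M : ℕ) : ℤ) (∑ i, b i • g i) σ = 0) → ∀ i, (2 : ℤ) ^ (M - d) ∣ b i :=
  fun b hb i ↦ dvd_trans (pow_dvd_pow 2 (by omega)) (hfree b hb i)

/-- The no-medium-class clause is monotone in the error. -/
theorem span_mono {W : WeierstrassCurve ℚ} [W.IsElliptic] {K : Type} [Field K] [NumberField K] {ι : K →+* ℂ}
    [∀ k : ℕ, NumberField (ringClassField K ι k)] {τ : K ≃ₐ[ℚ] K} {M e : ℕ} {u : ℤ} {a d t : ℕ}
    {g : Fin t → galH1Torsion (W.baseChange K) ((2 ^ M : ℕ) : ℤ)} (had : a ≤ d)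
    (hspan : ∀ y : galH1Torsion (W.baseChange K) ((2 ^ M : ℕ) : ℤ), y ∈ Jetchev2008.modifiedSelmerGroup W K ι ((2 ^ M : ℕ) : ℤ) e →
        conjAct W τ ((2 ^ M : ℕ) : ℤ) y = (-u) • y →
        ∃ b : Fin t → ℤ, ∀ σ ∈ torsionFixing (W.baseChange K) ((2 ^ (M + 1) : ℕ) : ℤ),
          h1Eval (W.baseChange K) ((2 ^ M : ℕ) : ℤ) (((2 : ℤ) ^ a) • y - ∑ i, b i • g i) σ = 0) :
    ∀ y : galH1Torsion (W.baseChange K) ((2 ^ M : ℕ) : ℤ), y ∈ Jetchev2008.modifiedSelmerGroup W K ι ((2 ^ M : ℕ) : ℤ) e →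
        conjAct W τ ((2 ^ M : ℕ) : ℤ) y = (-u) • y →
        ∃ b : Fin t → ℤ, ∀ σ ∈ torsionFixing (W.baseChange K) ((2 ^ (M + 1) : ℕ) : ℤ),
          h1Eval (W.baseChange K) ((2 ^ M : ℕ) : ℤ) (((2 : ℤ) ^ d) • y - ∑ i, b i • g i) σ = 0 := by
  intro y hy hyτ
  obtain ⟨b, hb⟩ := hspan y hy hyτ
  obtain ⟨r, rfl⟩ := Nat.exists_eq_add_of_le had
  refine ⟨fun i ↦ (2 : ℤ) ^ r * b i, fun σ hσ ↦ ?_⟩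
  have hle : torsionFixing (W.baseChange K) ((2 ^ (M + 1) : ℕ) : ℤ) ≤ torsionFixing (W.baseChange K) ((2 ^ M : ℕ) : ℤ) :=
    KolyvaginLowerBoundAtTwo.torsionFixing_le_of_dvd _ (KolyvaginAtTwo.RegularValueEngine.natCast_two_pow_dvd_succ M)
  have heq : ((2 : ℤ) ^ (a + r)) • y - ∑ i, ((2 : ℤ) ^ r * b i) • g i = (2 : ℤ) ^ r • (((2 : ℤ) ^ a) • y - ∑ i, b i • g i) := by
    rw [zsmul_sub, smul_smul, ← pow_add, add_comm r a, KolyvaginAtTwo.RegularWalk.zsmul_finset_sum]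
    simp only [smul_smul]
  rw [heq, h1Eval_zsmul _ _ _ _ (hle hσ), hb σ hσ, smul_zero]

/-- Shape errors are monotone: `Sh(t, a) ⟹ Sh(t, d)` for `a ≤ d` (same witness). -/
theorem oppShape_mono {W : WeierstrassCurve ℚ} [W.IsElliptic] {K : Type} [Field K] [NumberField K] {ι : K →+* ℂ}
    [∀ k : ℕ, NumberField (ringClassField K ι k)] {τ : K ≃ₐ[ℚ] K} {M e : ℕ} {u : ℤ} {a d t : ℕ} (had : a ≤ d)
    (h : OppShape W K ι τ M e u a t) : OppShape W K ι τ M e u d t := by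
  obtain ⟨g, hmem, hsign, hfree, hspan⟩ := h
  exact ⟨g, hmem, hsign, free_mono had hfree, span_mono had hspan⟩

/-- `KolSupp` is hereditary. [folklore] -/
theorem kolSupp_of_dvd {Kol : ℕ → Prop} {m n : ℕ} (h : Literature.NumberTheory.EllipticCurves.KolyvaginDescent.KolSupp Kol n) (hmn : m ∣ n) :
    Literature.NumberTheory.EllipticCurves.KolyvaginDescent.KolSupp Kol m :=
  ⟨h.1.squarefree_of_dvd hmn, fun q hq ↦ h.2 q (Nat.primeFactors_mono hmn h.1.ne_zero hq)⟩

/-- `KolSupp` of `n ℓ` for a fresh Kolyvagin prime `ℓ`. [folklore] -/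
theorem kolSupp_mul_of_prime {Kol : ℕ → Prop} {n ℓ : ℕ} (h : Literature.NumberTheory.EllipticCurves.KolyvaginDescent.KolSupp Kol n)
    (hℓ : ℓ.Prime) (hKℓ : Kol ℓ) (hℓn : ¬ ℓ ∣ n) :
    Literature.NumberTheory.EllipticCurves.KolyvaginDescent.KolSupp Kol (n * ℓ) := by
  have hcop : Nat.Coprime n ℓ := (Nat.coprime_comm.mp ((Nat.Prime.coprime_iff_not_dvd hℓ).mpr hℓn))
  refine ⟨(Nat.squarefree_mul hcop).mpr ⟨h.1, hℓ.squarefree⟩, fun q hq ↦ ?_⟩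
  rw [Nat.primeFactors_mul h.1.ne_zero hℓ.ne_zero, hℓ.primeFactors, Finset.mem_union, Finset.mem_singleton] at hq
  rcases hq with hq | rfl
  · exact h.2 q hq
  · exact hKℓ

/-- The margin `M ≤ M(n)` is hereditary. [folklore] -/
theorem levelIndex_of_dvd {W : WeierstrassCurve ℚ} [W.IsElliptic] [W.IsGloballyMinimal] {M m n : ℕ} (hn : n ≠ 0) (hmn : m ∣ n)
    (h : ((M : ℕ) : ℕ∞) ≤ Literature.NumberTheory.EllipticCurves.Zhang2014.levelIndex W 2 n) :
    ((M : ℕ) : ℕ∞) ≤ Literature.NumberTheory.EllipticCurves.Zhang2014.levelIndex W 2 m :=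
  Zhang2014.natCast_le_levelIndex_iff.mpr fun q hq ↦
    Zhang2014.natCast_le_levelIndex_iff.mp h q (Nat.primeFactors_mono hmn hn hq)

/-- The margin of `n ℓ`. [folklore] -/
theorem levelIndex_mul_of_prime {W : WeierstrassCurve ℚ} [W.IsElliptic] [W.IsGloballyMinimal] {M n ℓ : ℕ} (hn : n ≠ 0) (hℓ : ℓ.Prime)
    (h : ((M : ℕ) : ℕ∞) ≤ Literature.NumberTheory.EllipticCurves.Zhang2014.levelIndex W 2 n)
    (hℓM : M ≤ Literature.NumberTheory.EllipticCurves.Zhang2014.kolyvaginIndex W 2 ℓ) :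
    ((M : ℕ) : ℕ∞) ≤ Literature.NumberTheory.EllipticCurves.Zhang2014.levelIndex W 2 (n * ℓ) := by
  refine Zhang2014.natCast_le_levelIndex_iff.mpr fun q hq ↦ ?_
  rw [Nat.primeFactors_mul hn hℓ.ne_zero, hℓ.primeFactors, Finset.mem_union, Finset.mem_singleton] at hq
  rcases hq with hq | rfl
  · exact Zhang2014.natCast_le_levelIndex_iff.mp h q hq
  · exact hℓM

/-- An element of `E[n]` (as a subtype) is killed by `n` (kernel algebra). [folklore] -/
theorem geomTorsion_zsmul_self_eq_zero {k : Type} [Field k] (V : WeierstrassCurve k) (n : ℤ) (P : geomTorsion V n) :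
    n • P = 0 := by
  apply Subtype.ext
  rw [AddSubgroupClass.coe_zsmul, ZeroMemClass.coe_zero]
  exact (mem_geomTorsion_iff V n (P : geomPoints V)).mp P.2

/-- A class killed by `2` is not visible beyond `2^{x+1}`: if `2^{x+1}·[c, ρ] ≠ 0` then `2·c ≠ 0`. -/
theorem two_zsmul_ne_zero_of_vis {W : WeierstrassCurve ℚ} {K : Type} [Field K] [NumberField K] {M x : ℕ}
    {c : galH1Torsion (W.baseChange K) ((2 ^ M : ℕ) : ℤ)} {ρ : absoluteGaloisGroup K}
    (hρ : ρ ∈ torsionFixing (W.baseChange K) ((2 ^ M : ℕ) : ℤ))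
    (h : ((2 ^ (x + 1) : ℕ) : ℤ) • h1Eval (W.baseChange K) ((2 ^ M : ℕ) : ℤ) c ρ ≠ 0) : (2 : ℤ) • c ≠ 0 := by
  intro h2
  apply h
  have hsplit : ((2 ^ (x + 1) : ℕ) : ℤ) = ((2 ^ x : ℕ) : ℤ) * (2 : ℤ) := by push_cast; ring
  rw [hsplit, mul_smul, ← h1Eval_zsmul _ _ _ _ hρ, h2, h1Eval_zero _ _ hρ, smul_zero]

/-- The level exceeds any visible exponent: `2^x·[c, ρ] ≠ 0 ⟹ x < M`. -/
theorem lt_level_of_vis {W : WeierstrassCurve ℚ} {K : Type} [Field K] [NumberField K] {M x : ℕ}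
    {c : galH1Torsion (W.baseChange K) ((2 ^ M : ℕ) : ℤ)} {ρ : absoluteGaloisGroup K}
    (h : ((2 ^ x : ℕ) : ℤ) • h1Eval (W.baseChange K) ((2 ^ M : ℕ) : ℤ) c ρ ≠ 0) : x < M := by
  by_contra hle
  push Not at hle
  apply h
  exact KolyvaginLowerBoundAtTwo.two_pow_zsmul_eq_zero_of_le_swap hle
    (geomTorsion_zsmul_self_eq_zero _ _ _)

end Summit.BirchSwinnertonDyer.BirchSwinnertonDyer.Theorems.KolyvaginAtTwo.KolyvaginSwap

end
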